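import Summits.BirchSwinnertonDyer.BirchSwinnertonDyer.Theorems.PrintX8VSCBSDpAtPairOfCruxBodiesAt
import Summits.BirchSwinnertonDyer.BirchSwinnertonDyer.Theorems.PrintX8VSCSharpFlatMainConjectureContraAtPairIffCruxBodies
import Summits.BirchSwinnertonDyer.BirchSwinnertonDyer.Theorems.PrintX8VSCSharpFlatMainConjectureContraAllColoursOfBSDpRankZero
import HarnessLib

/-!
# Route `PrintX8VSC`, analytic rank ZERO: at one X8 pair `BSD(E,3)` ⟺ K(E,3) ∧ C(E,3) modulo print — on the rank-zero census pairs the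
# two research cruxes are EXACTLY the target (per pair and class-wide)

Cell `bsd-print-x8`, seat p3 (gen 10; «does BSTW 2024 cover `a_p ≠ 0` at `p = 3`? … no ⇒ the exact missing input is the crux»). Notation
as in `PrintX8VSCBSDpAtPairOfCruxBodiesAt` (K(W,p), C(W,p) = the bodies of the cruxes K′ = item 23732 / C′ = item 23733 of route
`PrintX8VSC` AT ONE PAIR; MC(W,p) = the body of MC′ = item 23742 at the pair). Three landed per-pair pieces are composed:

* p2 gen 7, p683032 §2 `X8KatoConverseContraExchange.X8.sharpFlatMainConjectureContra_at_of_bsdp_of_analyticRank_eq_zero` — at a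
  rank-zero X8 pair `BSDp W 3` ⟹ MC(W,3) (Greenberg's criterion, Kato 12.10 in length form, colour exchange on the joint packages);
* p3 gen 9, p682973 §3 `X8CruxBodiesAtPair.katoFineLowerAt_of_… / cyclotomicLowerAt_of_…` — MC(W,p) ⟹ K(W,p), MC(W,p) ⟹ C(W,p);
* p3 gen 10, `X8CruxBodiesAtPair.bsdp_of_cruxBodiesAt_of_analyticRank_eq_zero` — K(W,3) ∧ C(W,3) ⟹ `BSDp W 3` at a rank-zero pair
  (print facts only; no Kobayashi 2013, no BKO; THEOREM B and Sprung Thm. 2.2 in-kernel).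

* §1 `cruxBodiesAt_of_bsdp_of_analyticRank_eq_zero` — **`BSDp W 3` ⟹ K(W,3) ∧ C(W,3)** at an X8 pair of analytic rank `0` (any image).
* §2 `bsdp_iff_cruxBodiesAt_of_analyticRank_eq_zero` — **`BSDp W 3` ⟺ K(W,3) ∧ C(W,3) at every X8 pair of analytic rank `0`** (142 of
  the 217 census cells), modulo the displayed published facts {Sprung 2012 Thm. 7.14, Thm. 7.16 (contragredient reading), the
  `γ⁻¹`-keyed JOINT Coleman–Kato package, Sprung 2024 Lem. 5.9 all `N` (a kernel theorem elsewhere), period unit at 3, GZK,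
  modularity (newform, entire `L`)}.
* §3 `bsdp_rankZero_iff_cruxesRankZero` — CLASS FORM: (`BSDp` at every rank-zero X8 pair) ⟺ (K′↾{r_an = 0} ∧ C′↾{r_an = 0}), the
  bodies of the two cruxes with `W.analyticRank = 0 →` inserted after `ClassX8 W p →`, same facts.

READING (p3's sentence on the rank-zero locus). BSTW 2024 ((1.7) p. 6, §1.5 p. 11: `a₃ = 0`) reaches no X8 pair. On X8 ∩ {r_an = 0}
the route's research content K′ ∧ C′ is, pair by pair, EQUIVALENT modulo print to the leaf's own conclusion `BSD(E,3)`: the cruxes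
neither add to nor subtract from the target there (p2 g7: leaf↾r0 ≡ MC′↾r0; p3 g9: MC ≡ K ∧ C per pair; this file closes the
triangle). Consequences already noted by p2 g7 / p3 g9, now by name in one line: a `stub-false` witness against K′ or C′ at a rank-zero
pair is a counterexample to `BSD(E,3)` itself, so none sits at the 54 unit rank-zero census cells or at any cell with a per-pair
`BSDp` certificate; the open content of K′ ∧ C′ on the rank-zero locus is BSD₃ at the non-unit rank-zero X8 pairs. At analytic rank
`1` only ⟸ is in the kernel (`…OfCruxBodiesAt` §4, via the print-keyed BKO Cor. A.5 fact); the converse would need a ♯/♭ `p`-adic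
Gross–Zagier formula at `a₃ ≠ 0`, not in print. HONEST FRAMING: plumbing; conditional on displayed PUBLISHED facts; both sides OPEN at
the non-unit cells; `BSD(E,3)` on X8, K′, C′, MC′, the leaf and BSD are NOT proved. beyond-print theorem: no.

References: [Sprung2012] Thm. 2.2, Prop. 6.14, Thm. 7.14 (3), Thm. 7.16, Prop. 7.19, Main Conj. 7.21 (pp. 1487–1505), §7.5 l.1;
[Kato2004Asterisque] Conj. 12.10 (p. 224), §17.13 (p. 280); [BurungaleSkinnerTianWan2024] (1.7) (p. 6), §1.5 (p. 11); [Sprung2024] Thm.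
5.3, §5.2 Lemmas 5.5–5.9; [GreenbergLNM1716] §4 (p. 103); [Miller2011LMS] Def. 1.1; [GrossZagier1986] Thm. (7.3); [Kolyvagin1990] Thm. A.
-/

set_option linter.dupNamespace false
set_option autoImplicit false

noncomputable section

open scoped Classical NumberField MatrixGroups ModularForm

open NumberField IsDedekindDomain CongruenceSubgroup WeierstrassCurve Field
  Literature.NumberTheory.EllipticCurves Literature.NumberTheory.EllipticCurves.ModularForms
  Literature.NumberTheory.EllipticCurves.ZpExtension Literature.NumberTheory.EllipticCurves.Sprung2017
  Literature.NumberTheory.EllipticCurves.Sprung2012 Literature.NumberTheory.EllipticCurves.Rank1Residual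
  Literature.NumberTheory.EllipticCurves.IwasawaAlgebra Literature.NumberTheory.EllipticCurves.Kato2004
  Literature.NumberTheory.EllipticCurves.Module Literature.NumberTheory.EllipticCurves.Sprung2024
  Summit.BirchSwinnertonDyer.BirchSwinnertonDyer.Theorems
  Summit.BirchSwinnertonDyer.BirchSwinnertonDyer.Theorems.SmallImageSignedMuDefect
  Summit.BirchSwinnertonDyer.Rank1Residual.Supersingular

namespace Summit.BirchSwinnertonDyer.BirchSwinnertonDyer.Theorems.X8CruxBodiesAtPair

/-! ### §1 `BSD(E,3)` ⟹ K(E,3) ∧ C(E,3) at a rank-zero X8 pair -/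

/-- **`BSDp W 3` ⟹ K(W,3) ∧ C(W,3) at an X8 pair of analytic rank `0`** (ANY image, ANY conductor): p2's full rank-zero converse
(p683032 §2: `BSDp` ⟹ MC(W,3), every colour with `L^• ≠ 0`, every `γ⁻¹`-keyed dual — Greenberg's criterion, Kato 12.10 in length
form, colour exchange on the JOINT packages `hJc`, with the one-colour package `thm714seq_sharpFlatColemanKato_zeta_contra` obtained
from `hJc` by the proved projection `…_of_joint`) followed by the gen-9 per-pair halves MC ⟹ K (`katoFineLowerAt_of_…`, Thm. 7.14
displayed) and MC ⟹ C (`cyclotomicLowerAt_of_…`, fact-free). Displayed facts: h714, h716c, hJc, h59, h3, hGZK, hmod. CONDITIONAL;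
closes nothing. [cite: Sprung2012, Thm. 7.14 (3) (p. 1504), Prop. 7.19 and Main Conj. 7.21 (p. 1505)]
[cite: Kato2004Asterisque, Conj. 12.10 (p. 224) and §17.13 (p. 280)] [cite: GreenbergLNM1716, §4 (p. 103)] [cite: Miller2011LMS, Def. 1.1] -/
theorem cruxBodiesAt_of_bsdp_of_analyticRank_eq_zero
    (h714 : thm714_sharpFlatSelmerDual_finite_torsion) (h716c : thm716_sharpFlatCharIdeal_divisibility_contra)
    (hJc : thm714seq_sharpFlatColemanKato_zetaJoint_contra) (h59 : lem59AllN_sharpFlatCharValue_rankZero)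
    (h3 : realPeriodRat_eq_unit_mul_plusPeriod_three)
    (hGZK : rank_eq_analyticRank_of_analyticRank_le_one) (hmod : hasEntireLFunction_rat)
    (W : WeierstrassCurve ℚ) [W.IsElliptic] [W.IsGloballyMinimal] (p : ℕ) [Fact p.Prime]
    [ContinuousSMul ℤ_[p] (W.tateModule p)] [Module.Free ℤ_[p] (W.tateModule p)]
    [Module.Finite ℤ_[p] (W.tateModule p)] (hX : ClassX8 W p) (h0 : W.analyticRank = 0) (hB : BSDp W p) :
    (∀ (κ : ZpExtension ℚ p) (γ : Field.absoluteGaloisGroup ℚ),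
        κ.IsCyclotomic → κ.IsTopGenerator γ → IsCyclotomicVariable p γ →
      ∀ (v : HeightOneSpectrum (𝓞 ℚ)), (p : 𝓞 ℚ) ∈ v.asIdeal →
      ∀ (g : Field.absoluteGaloisGroup (v.adicCompletion ℚ)),
        κ.IsTopGenerator (resGalOfEmb (closureEmb (K := ℚ) (v.adicCompletion ℚ)) g) →
      ∀ (cneg : localPoints W (v.adicCompletion ℚ)) (c : ℕ → localPoints W (v.adicCompletion ℚ)),
        IsHondaSystem κ (closureEmb (K := ℚ) (v.adicCompletion ℚ)) W (W.frobeniusTrace p) g cneg c →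
      ∀ (N : ℕ) (_ : NeZero N) (f : CuspForm (Gamma0 N) 2) (ϖ : ℚ) (Lsharp Lflat : IwasawaAlgebra p),
        IsNewformOf W f → (ϖ : ℝ) * W.realPeriodRat = plusPeriod f →
        IsSprungPair f p (W.frobeniusTrace p) Lsharp Lflat →
      ∀ (I : Kato2004.IwasawaH1Data W p κ γ)
        (Cs : SharpFlatColemanKatoDataContra W p f ϖ κ γ (closureEmb (K := ℚ) (v.adicCompletion ℚ))
          (W.frobeniusTrace p) g c Chroma.sharp I)
        (Cf : SharpFlatColemanKatoDataContra W p f ϖ κ γ (closureEmb (K := ℚ) (v.adicCompletion ℚ))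
          (W.frobeniusTrace p) g c Chroma.flat I),
        Cs.Z = Cf.Z →
      ∀ (Y : W.FineSelmerDualData κ γ⁻¹) (𝔭 : PrimeSpectrum (IwasawaAlgebra p)), 𝔭.asIdeal.height = 1 →
        (p : IwasawaAlgebra p) ∉ 𝔭.asIdeal →
        (¬ ∃ n : ℕ, ((cyclotomicOmega p n).map (Int.castRingHom ℤ_[p]) : PowerSeries ℤ_[p]) ∈ 𝔭.asIdeal) →
        (∀ (col' : Chroma) (G' : IwasawaAlgebra p),
          iwasawaToPowerSeries p G' =
            PowerSeries.C (ϖ : ℚ_[p]) * iwasawaToPowerSeries p (chromaticL col' Lsharp Lflat) →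
          G' ∈ 𝔭.asIdeal) →
        Module.lengthAt (IwasawaAlgebra p) (I.H ⧸ Cs.Z) 𝔭 ≤ Module.lengthAt (IwasawaAlgebra p) Y.X 𝔭) ∧
    (∀ (col : Chroma) (κ : ZpExtension ℚ p) (γ : Field.absoluteGaloisGroup ℚ),
        κ.IsCyclotomic → κ.IsTopGenerator γ → IsCyclotomicVariable p γ →
      ∀ (v : HeightOneSpectrum (𝓞 ℚ)), (p : 𝓞 ℚ) ∈ v.asIdeal →
      ∀ (g : Field.absoluteGaloisGroup (v.adicCompletion ℚ)),
        κ.IsTopGenerator (resGalOfEmb (closureEmb (K := ℚ) (v.adicCompletion ℚ)) g) →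
      ∀ (cneg : localPoints W (v.adicCompletion ℚ)) (c : ℕ → localPoints W (v.adicCompletion ℚ)),
        IsHondaSystem κ (closureEmb (K := ℚ) (v.adicCompletion ℚ)) W (W.frobeniusTrace p) g cneg c →
      ∀ (N : ℕ) (_ : NeZero N) (f : CuspForm (Gamma0 N) 2) (ϖ : ℚ) (Lsharp Lflat : IwasawaAlgebra p),
        IsNewformOf W f → (ϖ : ℝ) * W.realPeriodRat = plusPeriod f →
        IsSprungPair f p (W.frobeniusTrace p) Lsharp Lflat → chromaticL col Lsharp Lflat ≠ 0 →
      ∀ (D : SharpFlatSelmerDualData W κ γ⁻¹ (closureEmb (K := ℚ) (v.adicCompletion ℚ))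
          (W.frobeniusTrace p) g c col) [Module.Finite (IwasawaAlgebra p) D.X],
        Module.IsTorsion (IwasawaAlgebra p) D.X →
      ∀ (G : IwasawaAlgebra p),
        iwasawaToPowerSeries p G =
          PowerSeries.C (ϖ : ℚ_[p]) * iwasawaToPowerSeries p (chromaticL col Lsharp Lflat) →
      ∀ (I : Kato2004.IwasawaH1Data W p κ γ)
        (Cs : SharpFlatColemanKatoDataContra W p f ϖ κ γ (closureEmb (K := ℚ) (v.adicCompletion ℚ))
          (W.frobeniusTrace p) g c Chroma.sharp I)
        (Cf : SharpFlatColemanKatoDataContra W p f ϖ κ γ (closureEmb (K := ℚ) (v.adicCompletion ℚ))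
          (W.frobeniusTrace p) g c Chroma.flat I),
        Cs.Z = Cf.Z →
      ∀ 𝔭 : PrimeSpectrum (IwasawaAlgebra p), 𝔭.asIdeal.height = 1 →
        (PowerSeries.X : IwasawaAlgebra p) ∉ 𝔭.asIdeal →
        (∃ j : ℕ, 1 ≤ j ∧
          ((((Polynomial.cyclotomic (p ^ j) ℤ).comp (Polynomial.X + 1)).map (Int.castRingHom ℤ_[p]) : Polynomial ℤ_[p]) :
            PowerSeries ℤ_[p]) ∈ 𝔭.asIdeal) →
        (∀ (col' : Chroma) (G' : IwasawaAlgebra p),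
          iwasawaToPowerSeries p G' =
            PowerSeries.C (ϖ : ℚ_[p]) * iwasawaToPowerSeries p (chromaticL col' Lsharp Lflat) →
          G' ∈ 𝔭.asIdeal) →
        Module.lengthAt (IwasawaAlgebra p) (IwasawaAlgebra p ⧸ Ideal.span {G}) 𝔭 ≤
          Module.lengthAt (IwasawaAlgebra p) D.X 𝔭) := by
  -- the one-colour contragredient package from the joint one (proved projection)
  have hCKc : thm714seq_sharpFlatColemanKato_zeta_contra := thm714seq_sharpFlatColemanKato_zeta_contra_of_joint hJc
  -- p2 g7: `BSD(E,3)` at the rank-zero pair ⟹ MC(W,p)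
  have hMCW := X8KatoConverseContraExchange.X8.sharpFlatMainConjectureContra_at_of_bsdp_of_analyticRank_eq_zero W p h714
    h716c hCKc hJc h59 h3 hGZK hmod hX h0 hB
  -- p3 g9: MC(W,p) ⟹ K(W,p) and MC(W,p) ⟹ C(W,p)
  exact ⟨katoFineLowerAt_of_sharpFlatMainConjectureContraAt h714 W p hX hMCW,
    cyclotomicLowerAt_of_sharpFlatMainConjectureContraAt W p hMCW⟩

/-! ### §2 The per-pair equivalence at analytic rank zero -/

/-- **`BSDp W 3` ⟺ K(W,3) ∧ C(W,3) at every X8 pair of analytic rank `0`** (the 142 rank-zero census cells `(E,3)`, `a₃ = ±3`, any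
image): modulo the displayed PUBLISHED facts — Sprung 2012 Thm. 7.14 (`h714`), Thm. 7.16 contragredient reading (`h716c`), the period
unit at 3 (`h3`), the `γ⁻¹`-keyed JOINT Coleman–Kato package (`hJc`), modularity (`hmodf` newform, `hmod` entire `L`), Sprung 2024
Lem. 5.9 all `N` (`h59`, a kernel theorem elsewhere), GZK (`hGZK`) — Miller's `BSD(E,3)` at the pair is EQUIVALENT to the conjunction
of the bodies of the route's two research cruxes K′ (23732) and C′ (23733) AT THE PAIR. ⟹: §1; ⟸: `bsdp_of_cruxBodiesAt_of_analyticRank_eq_zero`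
(THEOREM B and Sprung Thm. 2.2 in-kernel; no Kobayashi 2013, no BKO). p3's sentence on the rank-zero locus: BSTW 2024 ((1.7): `a₃ = 0`)
does not reach `(E,3)`, and what is missing there — K(E,3) ∧ C(E,3) = MC 7.21 at `(E,3)` — is EXACTLY `BSD(E,3)` modulo print: the
cruxes are neither stronger nor weaker than the target at a rank-zero pair. Both sides OPEN at the non-unit cells; nothing is asserted.
[cite: Sprung2012, Prop. 7.19 and Main Conj. 7.21 (p. 1505)] [cite: Kato2004Asterisque, Conj. 12.10 (p. 224)]
[cite: BurungaleSkinnerTianWan2024, (1.7) (p. 6) and §1.5 (p. 11)] [cite: Sprung2024, Thm. 5.3 (p. 38)] [cite: Miller2011LMS, Def. 1.1] -/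
theorem bsdp_iff_cruxBodiesAt_of_analyticRank_eq_zero
    (h714 : thm714_sharpFlatSelmerDual_finite_torsion) (h716c : thm716_sharpFlatCharIdeal_divisibility_contra)
    (h3 : realPeriodRat_eq_unit_mul_plusPeriod_three) (hJc : thm714seq_sharpFlatColemanKato_zetaJoint_contra)
    (hmodf : exists_isNewformOf) (h59 : lem59AllN_sharpFlatCharValue_rankZero)
    (hGZK : rank_eq_analyticRank_of_analyticRank_le_one) (hmod : hasEntireLFunction_rat)
    (W : WeierstrassCurve ℚ) [W.IsElliptic] [W.IsGloballyMinimal] (p : ℕ) [Fact p.Prime]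
    [ContinuousSMul ℤ_[p] (W.tateModule p)] [Module.Free ℤ_[p] (W.tateModule p)]
    [Module.Finite ℤ_[p] (W.tateModule p)] (hX : ClassX8 W p) (h0 : W.analyticRank = 0) :
    BSDp W p ↔
    (∀ (κ : ZpExtension ℚ p) (γ : Field.absoluteGaloisGroup ℚ),
        κ.IsCyclotomic → κ.IsTopGenerator γ → IsCyclotomicVariable p γ →
      ∀ (v : HeightOneSpectrum (𝓞 ℚ)), (p : 𝓞 ℚ) ∈ v.asIdeal →
      ∀ (g : Field.absoluteGaloisGroup (v.adicCompletion ℚ)),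
        κ.IsTopGenerator (resGalOfEmb (closureEmb (K := ℚ) (v.adicCompletion ℚ)) g) →
      ∀ (cneg : localPoints W (v.adicCompletion ℚ)) (c : ℕ → localPoints W (v.adicCompletion ℚ)),
        IsHondaSystem κ (closureEmb (K := ℚ) (v.adicCompletion ℚ)) W (W.frobeniusTrace p) g cneg c →
      ∀ (N : ℕ) (_ : NeZero N) (f : CuspForm (Gamma0 N) 2) (ϖ : ℚ) (Lsharp Lflat : IwasawaAlgebra p),
        IsNewformOf W f → (ϖ : ℝ) * W.realPeriodRat = plusPeriod f →
        IsSprungPair f p (W.frobeniusTrace p) Lsharp Lflat →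
      ∀ (I : Kato2004.IwasawaH1Data W p κ γ)
        (Cs : SharpFlatColemanKatoDataContra W p f ϖ κ γ (closureEmb (K := ℚ) (v.adicCompletion ℚ))
          (W.frobeniusTrace p) g c Chroma.sharp I)
        (Cf : SharpFlatColemanKatoDataContra W p f ϖ κ γ (closureEmb (K := ℚ) (v.adicCompletion ℚ))
          (W.frobeniusTrace p) g c Chroma.flat I),
        Cs.Z = Cf.Z →
      ∀ (Y : W.FineSelmerDualData κ γ⁻¹) (𝔭 : PrimeSpectrum (IwasawaAlgebra p)), 𝔭.asIdeal.height = 1 →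
        (p : IwasawaAlgebra p) ∉ 𝔭.asIdeal →
        (¬ ∃ n : ℕ, ((cyclotomicOmega p n).map (Int.castRingHom ℤ_[p]) : PowerSeries ℤ_[p]) ∈ 𝔭.asIdeal) →
        (∀ (col' : Chroma) (G' : IwasawaAlgebra p),
          iwasawaToPowerSeries p G' =
            PowerSeries.C (ϖ : ℚ_[p]) * iwasawaToPowerSeries p (chromaticL col' Lsharp Lflat) →
          G' ∈ 𝔭.asIdeal) →
        Module.lengthAt (IwasawaAlgebra p) (I.H ⧸ Cs.Z) 𝔭 ≤ Module.lengthAt (IwasawaAlgebra p) Y.X 𝔭) ∧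
    (∀ (col : Chroma) (κ : ZpExtension ℚ p) (γ : Field.absoluteGaloisGroup ℚ),
        κ.IsCyclotomic → κ.IsTopGenerator γ → IsCyclotomicVariable p γ →
      ∀ (v : HeightOneSpectrum (𝓞 ℚ)), (p : 𝓞 ℚ) ∈ v.asIdeal →
      ∀ (g : Field.absoluteGaloisGroup (v.adicCompletion ℚ)),
        κ.IsTopGenerator (resGalOfEmb (closureEmb (K := ℚ) (v.adicCompletion ℚ)) g) →
      ∀ (cneg : localPoints W (v.adicCompletion ℚ)) (c : ℕ → localPoints W (v.adicCompletion ℚ)),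
        IsHondaSystem κ (closureEmb (K := ℚ) (v.adicCompletion ℚ)) W (W.frobeniusTrace p) g cneg c →
      ∀ (N : ℕ) (_ : NeZero N) (f : CuspForm (Gamma0 N) 2) (ϖ : ℚ) (Lsharp Lflat : IwasawaAlgebra p),
        IsNewformOf W f → (ϖ : ℝ) * W.realPeriodRat = plusPeriod f →
        IsSprungPair f p (W.frobeniusTrace p) Lsharp Lflat → chromaticL col Lsharp Lflat ≠ 0 →
      ∀ (D : SharpFlatSelmerDualData W κ γ⁻¹ (closureEmb (K := ℚ) (v.adicCompletion ℚ))
          (W.frobeniusTrace p) g c col) [Module.Finite (IwasawaAlgebra p) D.X],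
        Module.IsTorsion (IwasawaAlgebra p) D.X →
      ∀ (G : IwasawaAlgebra p),
        iwasawaToPowerSeries p G =
          PowerSeries.C (ϖ : ℚ_[p]) * iwasawaToPowerSeries p (chromaticL col Lsharp Lflat) →
      ∀ (I : Kato2004.IwasawaH1Data W p κ γ)
        (Cs : SharpFlatColemanKatoDataContra W p f ϖ κ γ (closureEmb (K := ℚ) (v.adicCompletion ℚ))
          (W.frobeniusTrace p) g c Chroma.sharp I)
        (Cf : SharpFlatColemanKatoDataContra W p f ϖ κ γ (closureEmb (K := ℚ) (v.adicCompletion ℚ))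
          (W.frobeniusTrace p) g c Chroma.flat I),
        Cs.Z = Cf.Z →
      ∀ 𝔭 : PrimeSpectrum (IwasawaAlgebra p), 𝔭.asIdeal.height = 1 →
        (PowerSeries.X : IwasawaAlgebra p) ∉ 𝔭.asIdeal →
        (∃ j : ℕ, 1 ≤ j ∧
          ((((Polynomial.cyclotomic (p ^ j) ℤ).comp (Polynomial.X + 1)).map (Int.castRingHom ℤ_[p]) : Polynomial ℤ_[p]) :
            PowerSeries ℤ_[p]) ∈ 𝔭.asIdeal) →
        (∀ (col' : Chroma) (G' : IwasawaAlgebra p),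
          iwasawaToPowerSeries p G' =
            PowerSeries.C (ϖ : ℚ_[p]) * iwasawaToPowerSeries p (chromaticL col' Lsharp Lflat) →
          G' ∈ 𝔭.asIdeal) →
        Module.lengthAt (IwasawaAlgebra p) (IwasawaAlgebra p ⧸ Ideal.span {G}) 𝔭 ≤
          Module.lengthAt (IwasawaAlgebra p) D.X 𝔭) :=
  ⟨cruxBodiesAt_of_bsdp_of_analyticRank_eq_zero h714 h716c hJc h59 h3 hGZK hmod W p hX h0,
   fun h => bsdp_of_cruxBodiesAt_of_analyticRank_eq_zero W p h.1 h.2 h714 h716c h3 hJc hmodf h59 hGZK hmod hX h0⟩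

/-! ### §3 Class form on X8 ∩ {r_an = 0} -/

/-- **CLASS FORM on the rank-zero locus.** Modulo the same displayed published facts: (`BSDp W p` at EVERY X8 pair of analytic rank `0`,
under the three `T_pW`-instance binders the cruxes carry) ⟺ (K′↾{r_an = 0} ∧ C′↾{r_an = 0}) — the bodies of the route's cruxes
`KatoFineLowerSporadicGivenHeldX8Contra` (23732) / `CyclotomicLowerPosLevelGivenHeldX8Contra` (23733) with `W.analyticRank = 0 →`
inserted after `ClassX8 W p →` (the rank-zero halves of the pre-built repair texts K′R / C′R of p683494). Pair by pair from §2. So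
on X8 ∩ {r_an = 0} the research cruxes of `PrintX8VSC`, the main-conjecture node 23742 (p683032 §3) and the leaf say THE SAME THING
modulo print. CONDITIONAL; closes nothing; BSD is not proved. [cite: Sprung2012, Main Conj. 7.21 (p. 1505)]
[cite: Kato2004Asterisque, Conj. 12.10 (p. 224)] [cite: BurungaleSkinnerTianWan2024, §1.5 (p. 11)] [cite: Miller2011LMS, Def. 1.1] -/
theorem bsdp_rankZero_iff_cruxesRankZero
    (h714 : thm714_sharpFlatSelmerDual_finite_torsion) (h716c : thm716_sharpFlatCharIdeal_divisibility_contra)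
    (h3 : realPeriodRat_eq_unit_mul_plusPeriod_three) (hJc : thm714seq_sharpFlatColemanKato_zetaJoint_contra)
    (hmodf : exists_isNewformOf) (h59 : lem59AllN_sharpFlatCharValue_rankZero)
    (hGZK : rank_eq_analyticRank_of_analyticRank_le_one) (hmod : hasEntireLFunction_rat) :
    (∀ (W : WeierstrassCurve ℚ) [W.IsElliptic] [W.IsGloballyMinimal] (p : ℕ) [Fact p.Prime]
      [ContinuousSMul ℤ_[p] (W.tateModule p)] [Module.Free ℤ_[p] (W.tateModule p)]
      [Module.Finite ℤ_[p] (W.tateModule p)], ClassX8 W p → W.analyticRank = 0 → BSDp W p) ↔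
    ((∀ (W : WeierstrassCurve ℚ) [W.IsElliptic] [W.IsGloballyMinimal] (p : ℕ) [Fact p.Prime]
        [ContinuousSMul ℤ_[p] (W.tateModule p)] [Module.Free ℤ_[p] (W.tateModule p)]
        [Module.Finite ℤ_[p] (W.tateModule p)], ClassX8 W p → W.analyticRank = 0 →
      ∀ (κ : ZpExtension ℚ p) (γ : Field.absoluteGaloisGroup ℚ),
        κ.IsCyclotomic → κ.IsTopGenerator γ → IsCyclotomicVariable p γ →
      ∀ (v : HeightOneSpectrum (𝓞 ℚ)), (p : 𝓞 ℚ) ∈ v.asIdeal →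
      ∀ (g : Field.absoluteGaloisGroup (v.adicCompletion ℚ)),
        κ.IsTopGenerator (resGalOfEmb (closureEmb (K := ℚ) (v.adicCompletion ℚ)) g) →
      ∀ (cneg : localPoints W (v.adicCompletion ℚ)) (c : ℕ → localPoints W (v.adicCompletion ℚ)),
        IsHondaSystem κ (closureEmb (K := ℚ) (v.adicCompletion ℚ)) W (W.frobeniusTrace p) g cneg c →
      ∀ (N : ℕ) (_ : NeZero N) (f : CuspForm (Gamma0 N) 2) (ϖ : ℚ) (Lsharp Lflat : IwasawaAlgebra p),
        IsNewformOf W f → (ϖ : ℝ) * W.realPeriodRat = plusPeriod f →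
        IsSprungPair f p (W.frobeniusTrace p) Lsharp Lflat →
      ∀ (I : Kato2004.IwasawaH1Data W p κ γ)
        (Cs : SharpFlatColemanKatoDataContra W p f ϖ κ γ (closureEmb (K := ℚ) (v.adicCompletion ℚ))
          (W.frobeniusTrace p) g c Chroma.sharp I)
        (Cf : SharpFlatColemanKatoDataContra W p f ϖ κ γ (closureEmb (K := ℚ) (v.adicCompletion ℚ))
          (W.frobeniusTrace p) g c Chroma.flat I),
        Cs.Z = Cf.Z →
      ∀ (Y : W.FineSelmerDualData κ γ⁻¹) (𝔭 : PrimeSpectrum (IwasawaAlgebra p)), 𝔭.asIdeal.height = 1 →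
        (p : IwasawaAlgebra p) ∉ 𝔭.asIdeal →
        (¬ ∃ n : ℕ, ((cyclotomicOmega p n).map (Int.castRingHom ℤ_[p]) : PowerSeries ℤ_[p]) ∈ 𝔭.asIdeal) →
        (∀ (col' : Chroma) (G' : IwasawaAlgebra p),
          iwasawaToPowerSeries p G' =
            PowerSeries.C (ϖ : ℚ_[p]) * iwasawaToPowerSeries p (chromaticL col' Lsharp Lflat) →
          G' ∈ 𝔭.asIdeal) →
        Module.lengthAt (IwasawaAlgebra p) (I.H ⧸ Cs.Z) 𝔭 ≤ Module.lengthAt (IwasawaAlgebra p) Y.X 𝔭) ∧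
    (∀ (W : WeierstrassCurve ℚ) [W.IsElliptic] [W.IsGloballyMinimal] (p : ℕ) [Fact p.Prime]
        [ContinuousSMul ℤ_[p] (W.tateModule p)] [Module.Free ℤ_[p] (W.tateModule p)]
        [Module.Finite ℤ_[p] (W.tateModule p)], ClassX8 W p → W.analyticRank = 0 →
      ∀ (col : Chroma) (κ : ZpExtension ℚ p) (γ : Field.absoluteGaloisGroup ℚ),
        κ.IsCyclotomic → κ.IsTopGenerator γ → IsCyclotomicVariable p γ →
      ∀ (v : HeightOneSpectrum (𝓞 ℚ)), (p : 𝓞 ℚ) ∈ v.asIdeal →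
      ∀ (g : Field.absoluteGaloisGroup (v.adicCompletion ℚ)),
        κ.IsTopGenerator (resGalOfEmb (closureEmb (K := ℚ) (v.adicCompletion ℚ)) g) →
      ∀ (cneg : localPoints W (v.adicCompletion ℚ)) (c : ℕ → localPoints W (v.adicCompletion ℚ)),
        IsHondaSystem κ (closureEmb (K := ℚ) (v.adicCompletion ℚ)) W (W.frobeniusTrace p) g cneg c →
      ∀ (N : ℕ) (_ : NeZero N) (f : CuspForm (Gamma0 N) 2) (ϖ : ℚ) (Lsharp Lflat : IwasawaAlgebra p),
        IsNewformOf W f → (ϖ : ℝ) * W.realPeriodRat = plusPeriod f →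
        IsSprungPair f p (W.frobeniusTrace p) Lsharp Lflat → chromaticL col Lsharp Lflat ≠ 0 →
      ∀ (D : SharpFlatSelmerDualData W κ γ⁻¹ (closureEmb (K := ℚ) (v.adicCompletion ℚ))
          (W.frobeniusTrace p) g c col) [Module.Finite (IwasawaAlgebra p) D.X],
        Module.IsTorsion (IwasawaAlgebra p) D.X →
      ∀ (G : IwasawaAlgebra p),
        iwasawaToPowerSeries p G =
          PowerSeries.C (ϖ : ℚ_[p]) * iwasawaToPowerSeries p (chromaticL col Lsharp Lflat) →
      ∀ (I : Kato2004.IwasawaH1Data W p κ γ)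
        (Cs : SharpFlatColemanKatoDataContra W p f ϖ κ γ (closureEmb (K := ℚ) (v.adicCompletion ℚ))
          (W.frobeniusTrace p) g c Chroma.sharp I)
        (Cf : SharpFlatColemanKatoDataContra W p f ϖ κ γ (closureEmb (K := ℚ) (v.adicCompletion ℚ))
          (W.frobeniusTrace p) g c Chroma.flat I),
        Cs.Z = Cf.Z →
      ∀ 𝔭 : PrimeSpectrum (IwasawaAlgebra p), 𝔭.asIdeal.height = 1 →
        (PowerSeries.X : IwasawaAlgebra p) ∉ 𝔭.asIdeal →
        (∃ j : ℕ, 1 ≤ j ∧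
          ((((Polynomial.cyclotomic (p ^ j) ℤ).comp (Polynomial.X + 1)).map (Int.castRingHom ℤ_[p]) : Polynomial ℤ_[p]) :
            PowerSeries ℤ_[p]) ∈ 𝔭.asIdeal) →
        (∀ (col' : Chroma) (G' : IwasawaAlgebra p),
          iwasawaToPowerSeries p G' =
            PowerSeries.C (ϖ : ℚ_[p]) * iwasawaToPowerSeries p (chromaticL col' Lsharp Lflat) →
          G' ∈ 𝔭.asIdeal) →
        Module.lengthAt (IwasawaAlgebra p) (IwasawaAlgebra p ⧸ Ideal.span {G}) 𝔭 ≤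
          Module.lengthAt (IwasawaAlgebra p) D.X 𝔭)) := by
  refine ⟨fun hB => ⟨fun W _ _ p _ _ _ _ hX h0 => ?_, fun W _ _ p _ _ _ _ hX h0 => ?_⟩, fun h W _ _ p _ _ _ _ hX h0 => ?_⟩
  · exact (cruxBodiesAt_of_bsdp_of_analyticRank_eq_zero h714 h716c hJc h59 h3 hGZK hmod W p hX h0 (hB W p hX h0)).1
  · exact (cruxBodiesAt_of_bsdp_of_analyticRank_eq_zero h714 h716c hJc h59 h3 hGZK hmod W p hX h0 (hB W p hX h0)).2
  · exact bsdp_of_cruxBodiesAt_of_analyticRank_eq_zero W p (h.1 W p hX h0) (h.2 W p hX h0) h714 h716c h3 hJc hmodf h59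
      hGZK hmod hX h0

end Summit.BirchSwinnertonDyer.BirchSwinnertonDyer.Theorems.X8CruxBodiesAtPair

end
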